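import Literature.NumberTheory.LFunctions.RiemannHypothesisUpTo101
import Mathlib.Analysis.SpecialFunctions.Log.Deriv
import Mathlib.Analysis.SpecialFunctions.Pow.Deriv
import Mathlib.Analysis.SpecialFunctions.Gamma.Deligne
import Mathlib.NumberTheory.LSeries.RiemannZeta
import Mathlib.Algebra.Polynomial.Eval.Degree
import HarnessLib

/-!
# Barrier: the `𝔽₁`-zeta function of a polynomial counting function has all its zeros and poles at the integers `0, …, deg N` — it is never the (completed) Riemann zeta function (Soulé 2004; Kurokawa 2005; Deitmar 2006; Connes–Consani 2010)

Barrier catalogue `Literature/Barriers/RiemannHypothesis/` (D-0021), entry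
`AbsoluteZetaPolynomialCounting` (namespace `Literature.Barriers.RiemannHypothesis`; the catalogued
declaration is `AbsoluteZetaPolynomialCounting : Prop`, PROVED unconditionally as
`AbsoluteZetaPolynomialCounting_holds`; technique class `IsF1ZetaOfCountingPolynomial`).  No new
named fact: every statement of this file is a theorem (D-0014/D-0026).

## The technique (zeta functions "over `𝔽₁`" from polynomial point counts)

Manin's question, as taken up by Connes–Consani [ConnesConsani2010SchemesF1, §1 p. 2]: "Can one find
a 'curve' `C = Spec ℤ‾` over `𝔽₁` (defined in a suitable sense) whose zeta function `ζ_C(s)` is the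
complete Riemann zeta function `ζ_ℚ(s) = π^{−s/2} Γ(s/2) ζ(s)`?"  The zeta function over `𝔽₁` in
print is Soulé's [Soule2004F1, §6], in the form recalled in [ConnesConsani2010SchemesF1, §2 (first
display)]: for a variety `X` with a POLYNOMIAL counting function `N(x) ∈ ℤ[x]`, `#X(𝔽_q) = N(q)`,
"`ζ_X(s) := lim_{q→1} Z(X, q^{−s}) (q−1)^{N(1)}, s ∈ ℝ`", where `Z(X,T) = exp(Σ_{r≥1} N(q^r)T^r/r)`
is the Hasse–Weil exponential series.  Kurokawa [Kurokawa2005ZetaF1]: a `ℤ`-scheme `X` is of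
*`𝔽₁`-type* (Def. 1, p. 180) iff `ζ(s; X/ℤ) = ∏_{k=0}^n ζ(s−k)^{a_k}`, equivalently (Thm. 1)
`ζ(s; X/𝔽_p) = ∏_{k=0}^n (1 − p^{k−s})^{−a_k}` for all `p`, equivalently `#X(𝔽_{p^m}) = N_X(p^m)` for
a polynomial `N_X(t) = Σ_{k=0}^n a_k t^k`, `a_k ∈ ℤ`; then `ζ(s; X/𝔽₁) := ∏_{k=0}^n (s−k)^{−a_k}` and
(Thm. 2, p. 181) "`ζ(s; X/𝔽₁) = lim_{p→1} ζ(s; X/𝔽_p)(p−1)^{#X(𝔽₁)}`", `#X(𝔽₁) = N_X(1) = Σ a_k` the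
Euler characteristic (p. 181); Remark 3: "Soulé and Deitmar use `ζ(s; X/𝔽₁)^{−1}`".  Deitmar
[Deitmar2006ZetaKTheoryF1, Thm. 1 p. 141]: every `ℤ`-scheme of finite type *defined over `𝔽₁`*
(ascent of a monoid scheme) has a unique *zeta-polynomial* `N ∈ ℤ[x]` with `#X(𝔽_q) = N(q)` whenever
`(q−1, e) = 1`, and "`ζ_{X|𝔽₁}(s) = s^{a_0}(s−1)^{a_1}⋯(s−n)^{a_n}`" (p. 141).  Connes–Consani
[ConnesConsani2010SchemesF1, Thm. 4.10]: for a Noetherian `𝔽₁`-scheme whose geometric monoid scheme is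
torsion free, `#X(𝔽_{1^n}) = N(n+1)` with `N(x+1)` a polynomial with positive integral coefficients,
`#X_ℤ(𝔽_q) = N(q)`, and `ζ_X(s) = ∏_{x∈X} (1 − 1/s)^{−⊗ n(x)}`, obtained from "the well-known fact
`N(x) = Σ_0^d a_k x^k ⟹ ζ_X(s) = ∏_0^d (s−k)^{−a_k}`" (display in the proof of Thm. 4.10, §4.4).
This covers the objects of the `𝔽₁`-geometries whose zeta function is defined through point counts:
toric varieties, flag varieties `G/P` and other cellular schemes, Deitmar's monoid schemes,
Connes–Consani's `𝔽₁`-schemes (examples: `ζ(s; ℙⁿ/𝔽₁) = 1/(s(s−1)⋯(s−n))`, `ζ(s; GL₁/𝔽₁) = s/(s−1)`,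
[Kurokawa2005ZetaF1, Thm. 3]).

## The obstruction (what this file vendors), PROVED

For EVERY `N ∈ ℤ[x]` the function `ζ_N(s) = ∏_{k=0}^{deg N} (s−k)^{−a_k}` is a rational function of
`s` whose zeros (`a_k < 0`) and poles (`a_k > 0`) all lie in `{0, 1, …, deg N} ⊂ ℤ`
(`absoluteZeta_eq_zero_iff`); in particular `ζ_N(s) ≠ 0, ∞` at every non-real `s`
(`absoluteZeta_ne_zero_of_im_ne_zero`), so `ζ_N` vanishes at NO non-trivial zero of `ζ`, whereas
`ξ = Λ = completedRiemannZeta` vanishes at a zero `ρ` on the critical line with `0 < Im ρ ≤ 101`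
(certified in the tree: `Literature.NumberTheory.LFunctions.criticalZeroCount_hundredOne`,
`N₀(101) = 29`, the first being `ρ₁ = ½ + i·14.13…`; `exists_completedRiemannZeta_zero`).  Hence `ζ_N ≠ ξ` and `ζ_N ≠ ζ` for every counting polynomial
(`absoluteZeta_ne_completedRiemannZeta`, `absoluteZeta_ne_riemannZeta`): Manin's question has a
negative answer inside the class of polynomial counting functions.  Connes–Consani state the
obstruction through the Euler characteristic: "the value `N(1)` is conjectured to take the meaning
of the Euler characteristic of the curve `C` … Since one expects `C` to be of infinite genus
([Manin]), `N(1)` is supposed to take the value `−∞`, thus precluding any easy use of the limit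
definition of the zeta and a naive approach to the definition of `C`, by generalizing the
constructions of [Soulé]" [ConnesConsani2010SchemesF1, §1 pp. 2–3], and prove what `N` must be
instead (Thm. 2.2, Remark 2.3: a positive DISTRIBUTION with `N(1) = −∞`, see `evasions_known`).

Also proved here, so that `absoluteZeta` is tied to the printed limit definition and not merely
postulated: Kurokawa's Theorem 1 computation `Z_N(q, q^{−s}) = ∏_k (1 − q^{k−s})^{−a_k}`
(`f1HasseWeilZeta_eq_prod`, `q > 1`, real `s > deg N`, via the logarithmic series) and Soulé's
limit / Kurokawa's Theorem 2 `lim_{q→1⁺} (q−1)^{N(1)} Z_N(q,q^{−s}) = ∏_k (s−k)^{−a_k}`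
(`tendsto_soule_limit`, each factor `(1−q^{k−s})/(q−1) → s−k` being the derivative of `q ↦ q^{k−s}`
at `q = 1`).

## References

* [Soule2004F1] C. Soulé, *Les variétés sur le corps à un élément*, Mosc. Math. J. 4 (2004)
  217–244, §6 (definition of `ζ_X` by the limit `q → 1`; cited through [ConnesConsani2010SchemesF1,
  §1 and §2 first display] and [Deitmar2006ZetaKTheoryF1, p. 141], which restate it — the Moscow
  journal text itself was not re-read for this entry).
* [Kurokawa2005ZetaF1] N. Kurokawa, *Zeta functions over `𝔽₁`*, Proc. Japan Acad. 81A (2005)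
  180–184, doi:10.3792/pjaa.81.180 (read: Def. 1 and Thm. 1 p. 180; Thm. 2, Remark 3, Thm. 3,
  Thm. 4 p. 181; proofs of Thms. 1–2 p. 183, incl. "`ζ(s; GL₁/𝔽₁) = s/(s−1)`").
* [Deitmar2006ZetaKTheoryF1] A. Deitmar, *Remarks on zeta functions and `K`-theory over `𝔽₁`*,
  Proc. Japan Acad. 82A (2006) 141–146, doi:10.3792/pjaa.82.141 (read: p. 141 Soulé's condition,
  the limit definition, "`ζ_{X|𝔽₁}(s) = s^{a_0}(s−1)^{a_1}⋯(s−n)^{a_n}`", Thm. 1 (zeta-polynomial),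
  `χ(X) = N_X(1)`; p. 142 "`Z_{X_ℤ}(p,T) = ∏_{k=0}^n (1 − p^k T)^{−a_k}`", `b_l = a_{l/2}`).
* [ConnesConsani2010SchemesF1] A. Connes, C. Consani, *Schemes over `𝔽₁` and zeta functions*,
  Compositio Math. 146 (2010) 1383–1415 = arXiv:0903.2024 (read in the arXiv text: §1 (Manin's
  question, the `N(1) = −∞` obstruction, statements (1)–(3)); §2 first display (Soulé's `ζ_X`),
  Lemma 2.1, §2.2, Thm. 2.2, Remark 2.3 and the paragraph after it; §4.4 Thm. 4.10 with its proof
  and the display "`N(x) = Σ a_k x^k ⟹ ζ_X(s) = ∏(s−k)^{−a_k}`", the example `ζ_{ℙ¹} = 1/(s(s−1))`).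
* [Manin1995ZetaMotives] Yu. I. Manin, *Lectures on zeta functions and motives (according to
  Deninger and Kurokawa)*, Astérisque 228 (1995) 121–163, §1.5 (the absolute-motive question and
  the "infinite genus" of `Spec ℤ`; cited through [ConnesConsani2010SchemesF1, §1] and
  [Kurokawa2005ZetaF1, ref. [9]]).
* [Edwards1974] H. M. Edwards, *Riemann's Zeta Function*, §6.6 — through the tree's certificate
  `Literature.NumberTheory.LFunctions.RiemannHypothesisUpTo101` (`N(101) = N₀(101) = 29`).

## Design notes

* `absoluteZeta N : ℂ → ℂ` is the closed form `∏_{k ≤ natDegree N} (s − k)^(−coeff N k)` (integer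
  powers `zpow`), in Kurokawa's / Connes–Consani's sign convention (poles for `a_k > 0`); Soulé's
  and Deitmar's `ζ` is its inverse and has the same divisor support.  At a pole Lean's `zpow` returns
  the junk value `0⁻¹ = 0`, so `absoluteZeta_eq_zero_iff` describes the SUPPORT OF THE DIVISOR
  (zeros ∪ poles) — which is the content of the barrier.
* The limit theorems are real (`s ∈ ℝ`, as in [ConnesConsani2010SchemesF1, §2]; one-sided
  `q → 1⁺`, where `Z_N(q,q^{−s})` converges for `s > deg N`); the passage to complex `s` is the
  rational continuation `absoluteZeta` (`absoluteZeta_ofReal`), exactly as in print ("where we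
  consider `p` as a complex variable", [Kurokawa2005ZetaF1, Thm. 2]).
* `𝔽₁`-schemes themselves (Deitmar's monoid schemes, Connes–Consani's `𝔽₁`-functors) are not in
  the tree; the barrier quantifies over their common output, the counting polynomial `N ∈ ℤ[x]`,
  which is all that enters `ζ_X` ([Deitmar2006ZetaKTheoryF1, Thm. 1]; [ConnesConsani2010SchemesF1,
  Thm. 4.10]).
-/

noncomputable section

open Filter Topology Polynomial Finset Complex

namespace Literature.Barriers.RiemannHypothesis

open Literature.NumberTheory.LFunctions

/-! ## §1. The objects: counting polynomial, Hasse–Weil series at `q`, Soulé's limit, absolute zeta -/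

/-- The counting function `N(x) ∈ ℤ[x]` evaluated at a real number (`#X(𝔽_q) = N(q)`).
[cite: Kurokawa2005ZetaF1, Thm. 1 (3)] -/
def f1Count (N : ℤ[X]) (x : ℝ) : ℝ :=
  N.eval₂ (Int.castRingHom ℝ) x

/-- `log Z_N(q, q^{-s}) = Σ_{r ≥ 1} N(q^r) q^{-rs} / r`, the logarithm of the Hasse–Weil
exponential series `Z(X,T) = exp(Σ_{r≥1} N(q^r) T^r / r)` at `T = q^{-s}`.
[cite: ConnesConsani2010SchemesF1, §2 (second display) and §2.1] -/
def f1HasseWeilLog (N : ℤ[X]) (q s : ℝ) : ℝ :=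
  ∑' r : ℕ, f1Count N (q ^ (r + 1)) * q ^ (-(((r : ℝ) + 1) * s)) / ((r : ℝ) + 1)

/-- `Z_N(q, q^{-s}) = exp(Σ_{r ≥ 1} N(q^r) q^{-rs} / r)` (`= ζ(s; X/𝔽_q)` when `#X(𝔽_{q^r}) = N(q^r)`).
[cite: ConnesConsani2010SchemesF1, §2 (second display)] [cite: Kurokawa2005ZetaF1, p. 180] -/
def f1HasseWeilZeta (N : ℤ[X]) (q s : ℝ) : ℝ :=
  Real.exp (f1HasseWeilLog N q s)

/-- The absolute (`𝔽₁`-) zeta function of the counting polynomial `N(x) = Σ_k a_k x^k`, real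
variable: `ζ_N(s) = ∏_{k=0}^{deg N} (s − k)^{−a_k}` (Kurokawa's `ζ(s; X/𝔽₁)`, Connes–Consani's
`ζ_X(s)`; Soulé and Deitmar use the inverse). [cite: Kurokawa2005ZetaF1, Thm. 2 and its proof p. 183]
[cite: ConnesConsani2010SchemesF1, §4.4, display "N(x)=Σ a_k x^k ⟹ ζ_X(s)=∏(s−k)^{−a_k}" in the proof of Thm. 4.10] -/
def absoluteZetaReal (N : ℤ[X]) (s : ℝ) : ℝ :=
  ∏ k ∈ range (N.natDegree + 1), (s - k) ^ (-(N.coeff k))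

/-- The absolute (`𝔽₁`-) zeta function of the counting polynomial `N(x) = Σ_k a_k x^k` as a function
of a complex variable: `ζ_N(s) = ∏_{k=0}^{deg N} (s − k)^{−a_k}` ("where we consider p as a complex
variable"; Deitmar: `ζ_{X|𝔽₁}(s) = s^{a_0}(s−1)^{a_1}⋯(s−n)^{a_n}`, the inverse convention, Kurokawa's
Remark 3).  In Lean a pole (`a_k > 0`, `s = k`) takes the junk value `0⁻¹ = 0`.
[cite: Kurokawa2005ZetaF1, Thm. 2, Remark 3] [cite: Deitmar2006ZetaKTheoryF1, p. 141] -/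
def absoluteZeta (N : ℤ[X]) (s : ℂ) : ℂ :=
  ∏ k ∈ range (N.natDegree + 1), (s - k) ^ (-(N.coeff k))

/-- The complex absolute zeta function restricted to the reals is the real one ("where we
consider `p` as a complex variable when taking the limit"). [cite: Kurokawa2005ZetaF1, Thm. 2 p. 181] -/
theorem absoluteZeta_ofReal (N : ℤ[X]) (s : ℝ) :
    absoluteZeta N s = (absoluteZetaReal N s : ℂ) := by
  unfold absoluteZeta absoluteZetaReal
  push_cast
  rfl

/-! ## §2. Kurokawa's Theorem 1 computation: `Z_N(q, q^{-s}) = ∏_k (1 − q^{k−s})^{−a_k}` -/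

/-- `(q^{r+1})^k · q^{−(r+1)s} = (q^{k−s})^{r+1}` for `q > 0` (exponent bookkeeping). [folklore] -/
private theorem pow_mul_rpow_eq {q : ℝ} (hq : 0 < q) (s : ℝ) (r k : ℕ) :
    (q ^ (r + 1)) ^ k * q ^ (-(((r : ℝ) + 1) * s)) = (q ^ ((k : ℝ) - s)) ^ (r + 1) := by
  rw [← pow_mul, ← Real.rpow_natCast q ((r + 1) * k), ← Real.rpow_add hq,
    ← Real.rpow_natCast (q ^ ((k : ℝ) - s)) (r + 1), ← Real.rpow_mul hq.le]
  congr 1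
  push_cast
  ring

/-- The `r`-th term of `log Z_N(q,q^{−s})` is `Σ_k a_k (q^{k−s})^{r+1}/(r+1)`. [folklore] -/
private theorem f1_term_eq (N : ℤ[X]) {q : ℝ} (hq : 0 < q) (s : ℝ) (r : ℕ) :
    f1Count N (q ^ (r + 1)) * q ^ (-(((r : ℝ) + 1) * s)) / ((r : ℝ) + 1) =
      ∑ k ∈ range (N.natDegree + 1),
        (N.coeff k : ℝ) * ((q ^ ((k : ℝ) - s)) ^ (r + 1) / ((r : ℝ) + 1)) := by
  rw [f1Count, eval₂_eq_sum_range, sum_mul, sum_div]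
  refine sum_congr rfl fun k _ => ?_
  rw [← pow_mul_rpow_eq hq s r k]
  simp only [eq_intCast]
  ring

/-- `q^{k−s} < 1` for `q > 1` and `k ≤ deg N < s`. [folklore] -/
private theorem rpow_sub_lt_one {q s : ℝ} (hq : 1 < q) {N : ℤ[X]} (hs : (N.natDegree : ℝ) < s)
    {k : ℕ} (hk : k ∈ range (N.natDegree + 1)) : q ^ ((k : ℝ) - s) < 1 := by
  have hk' : (k : ℝ) ≤ N.natDegree := by exact_mod_cast Nat.lt_succ_iff.mp (mem_range.mp hk)
  exact Real.rpow_lt_one_of_one_lt_of_neg hq (by linarith)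

/-- **The logarithm of the Hasse–Weil series of a counting polynomial** (`q > 1`, `s > deg N`):
`Σ_{r≥1} N(q^r) q^{−rs}/r = −Σ_k a_k log(1 − q^{k−s})` — Kurokawa's comparison
"`log ζ(s; X/𝔽_p) = Σ_m #X(𝔽_{p^m}) p^{−ms}/m` and `log ∏_k (1−p^{k−s})^{−a_k} = Σ_m Σ_k a_k p^{mk} p^{−ms}/m`".
[cite: Kurokawa2005ZetaF1, proof of Thm. 1, p. 183] -/
theorem f1HasseWeilLog_eq {N : ℤ[X]} {q s : ℝ} (hq : 1 < q) (hs : (N.natDegree : ℝ) < s) :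
    f1HasseWeilLog N q s =
      ∑ k ∈ range (N.natDegree + 1), (N.coeff k : ℝ) * -Real.log (1 - q ^ ((k : ℝ) - s)) := by
  have hq0 : 0 < q := one_pos.trans hq
  have hsum : HasSum (fun r : ℕ => ∑ k ∈ range (N.natDegree + 1),
      (N.coeff k : ℝ) * ((q ^ ((k : ℝ) - s)) ^ (r + 1) / ((r : ℝ) + 1)))
      (∑ k ∈ range (N.natDegree + 1), (N.coeff k : ℝ) * -Real.log (1 - q ^ ((k : ℝ) - s))) := by
    refine hasSum_sum fun k hk => HasSum.mul_left _ ?_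
    have hx1 : |q ^ ((k : ℝ) - s)| < 1 := by
      rw [abs_of_pos (Real.rpow_pos_of_pos hq0 _)]
      exact rpow_sub_lt_one hq hs hk
    exact Real.hasSum_pow_div_log_of_abs_lt_one hx1
  rw [f1HasseWeilLog]
  simp_rw [f1_term_eq N hq0 s]
  exact hsum.tsum_eq

/-- **Kurokawa's Theorem 1, (2) ⟺ (3), as a computation** (`q > 1`, `s > deg N` real): if
`#X(𝔽_{q^r}) = N(q^r)` with `N(x) = Σ_{k=0}^n a_k x^k ∈ ℤ[x]`, then
`ζ(s; X/𝔽_q) = exp(Σ_{r≥1} N(q^r) q^{−rs}/r) = ∏_{k=0}^n (1 − q^{k−s})^{−a_k}`.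
[cite: Kurokawa2005ZetaF1, Thm. 1 and its proof p. 183] [cite: Deitmar2006ZetaKTheoryF1, p. 142 "Z_{X_ℤ}(p,T) = ∏_{k=0}^n (1 − p^k T)^{−a_k}"] -/
theorem f1HasseWeilZeta_eq_prod {N : ℤ[X]} {q s : ℝ} (hq : 1 < q) (hs : (N.natDegree : ℝ) < s) :
    f1HasseWeilZeta N q s =
      ∏ k ∈ range (N.natDegree + 1), (1 - q ^ ((k : ℝ) - s)) ^ (-(N.coeff k)) := by
  rw [f1HasseWeilZeta, f1HasseWeilLog_eq hq hs, Real.exp_sum]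
  refine prod_congr rfl fun k hk => ?_
  have hpos : 0 < 1 - q ^ ((k : ℝ) - s) := by linarith [rpow_sub_lt_one hq hs hk]
  rw [show (N.coeff k : ℝ) * -Real.log (1 - q ^ ((k : ℝ) - s)) =
      Real.log (1 - q ^ ((k : ℝ) - s)) * ((-(N.coeff k) : ℤ) : ℝ) by push_cast; ring,
    ← Real.rpow_def_of_pos hpos, Real.rpow_intCast]

/-! ## §3. Soulé's limit `q → 1`: `lim (q−1)^{N(1)} Z_N(q,q^{-s}) = ∏_k (s−k)^{−a_k}` (Kurokawa's Theorem 2) -/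

/-- `a^{Σ_i f i} = ∏_i a^{f i}` for integer exponents and `a ≠ 0`. [folklore] -/
private theorem zpow_finsetSum {a : ℝ} (ha : a ≠ 0) {ι : Type*} (t : Finset ι) (f : ι → ℤ) :
    a ^ (∑ i ∈ t, f i) = ∏ i ∈ t, a ^ (f i) := by
  induction t using Finset.cons_induction with
  | empty => simp
  | cons i t hi ih => rw [sum_cons, prod_cons, zpow_add₀ ha, ih]

/-- `N(1) = Σ_k a_k` (= `#X(𝔽₁)`, the Euler characteristic). [cite: Kurokawa2005ZetaF1, p. 181 "Σ a_k = Σ (−1)^l b_l is the Euler characteristic"]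
[cite: Deitmar2006ZetaKTheoryF1, p. 141 "χ(X) = N_X(1)"] -/
theorem eval_one_eq_sum_coeff (N : ℤ[X]) :
    N.eval 1 = ∑ k ∈ range (N.natDegree + 1), N.coeff k := by
  simp [eval_eq_sum_range]

/-- **Soulé's expression regrouped factor by factor** (`q > 1`, `s > deg N`):
`(q−1)^{N(1)} Z_N(q,q^{−s}) = ∏_k ((1 − q^{k−s})/(q−1))^{−a_k}` — the first display of Kurokawa's
proof of Theorem 2 ("`ζ(s; X/𝔽_p)(p−1)^{#X(𝔽₁)} = ∏_k ((1−p^{k−s})/(p−1))^{−a_k}`").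
[cite: Kurokawa2005ZetaF1, proof of Thm. 2, p. 183] -/
theorem soule_expression_eq {N : ℤ[X]} {q s : ℝ} (hq : 1 < q) (hs : (N.natDegree : ℝ) < s) :
    (q - 1) ^ (N.eval 1) * f1HasseWeilZeta N q s =
      ∏ k ∈ range (N.natDegree + 1), ((1 - q ^ ((k : ℝ) - s)) / (q - 1)) ^ (-(N.coeff k)) := by
  have hq1 : q - 1 ≠ 0 := sub_ne_zero.mpr hq.ne'
  rw [f1HasseWeilZeta_eq_prod hq hs, eval_one_eq_sum_coeff, zpow_finsetSum hq1, ← prod_mul_distrib]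
  refine prod_congr rfl fun k _ => ?_
  rw [div_zpow, div_eq_mul_inv, zpow_neg (q - 1), inv_inv]
  exact mul_comm _ _

/-- `(1 − q^c)/(q − 1) → −c` as `q → 1⁺` (the derivative of `q ↦ q^c` at `q = 1`), i.e.
"`lim_{p→1} (1 − p^{k−s})/(p − 1) = s − k`". [cite: Kurokawa2005ZetaF1, proof of Thm. 2, p. 183] -/
theorem tendsto_one_sub_rpow_div (c : ℝ) :
    Tendsto (fun q : ℝ => (1 - q ^ c) / (q - 1)) (𝓝[>] 1) (𝓝 (-c)) := by
  have hd : HasDerivAt (fun x : ℝ => x ^ c) c 1 := by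
    simpa using Real.hasDerivAt_rpow_const (x := 1) (p := c) (Or.inl one_ne_zero)
  have ht : Tendsto (slope (fun x : ℝ => x ^ c) 1) (𝓝[≠] 1) (𝓝 c) :=
    hasDerivAt_iff_tendsto_slope.mp hd
  have ht' : Tendsto (fun q => -slope (fun x : ℝ => x ^ c) 1 q) (𝓝[>] 1) (𝓝 (-c)) :=
    (ht.mono_left (nhdsWithin_mono _ fun x hx => ne_of_gt hx)).neg
  refine ht'.congr' (eventually_nhdsWithin_of_forall fun q _ => ?_)
  simp only [slope_def_field, Real.one_rpow]
  rw [← neg_div, neg_sub]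

/-- **Soulé's limit = Kurokawa's Theorem 2 = Connes–Consani's (2.1)/(4.7)** (real `s > deg N`,
`q → 1⁺`): `lim_{q→1} (q − 1)^{N(1)} Z_N(q, q^{−s}) = ∏_{k=0}^{deg N} (s − k)^{−a_k} = ζ_N(s)`
("`ζ(s; X/𝔽₁) = lim_{p→1} ζ(s; X/𝔽_p)(p − 1)^{#X(𝔽₁)}`"; CC: "`ζ_X(s) := lim_{q→1} Z(X,q^{−s})(q−1)^{N(1)}`,
`s ∈ ℝ`" and "`N(x) = Σ_0^d a_k x^k ⟹ ζ_X(s) = ∏_0^d (s−k)^{−a_k}`"; Deitmar p. 141, inverse convention).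
[cite: Kurokawa2005ZetaF1, Thm. 2 p. 181, proof p. 183] [cite: ConnesConsani2010SchemesF1, §2 (first display) and §4.4 (display in the proof of Thm. 4.10)]
[cite: Deitmar2006ZetaKTheoryF1, p. 141] [cite: Soule2004F1, §6 (as restated in ConnesConsani2010SchemesF1 §2)] -/
theorem tendsto_soule_limit {N : ℤ[X]} {s : ℝ} (hs : (N.natDegree : ℝ) < s) :
    Tendsto (fun q : ℝ => (q - 1) ^ (N.eval 1) * f1HasseWeilZeta N q s) (𝓝[>] 1)
      (𝓝 (absoluteZetaReal N s)) := by
  unfold absoluteZetaReal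
  have key : Tendsto (fun q : ℝ => ∏ k ∈ range (N.natDegree + 1),
      ((1 - q ^ ((k : ℝ) - s)) / (q - 1)) ^ (-(N.coeff k))) (𝓝[>] 1)
      (𝓝 (∏ k ∈ range (N.natDegree + 1), ((s : ℝ) - k) ^ (-(N.coeff k)))) := by
    refine tendsto_finsetProd _ fun k hk => ?_
    have hk' : (k : ℝ) ≤ N.natDegree := by exact_mod_cast Nat.lt_succ_iff.mp (mem_range.mp hk)
    have hsk : -((k : ℝ) - s) ≠ 0 := by rw [neg_sub]; exact sub_ne_zero.mpr (by linarith : s ≠ k)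
    have := (tendsto_one_sub_rpow_div ((k : ℝ) - s)).zpow₀ (-(N.coeff k)) (Or.inl hsk)
    simpa only [neg_sub] using this
  exact key.congr' (eventually_nhdsWithin_of_forall fun q hq => (soule_expression_eq hq hs).symm)

/-- The complex form of Soulé's limit: for real `s > deg N`, the product `ζ_N(s)` is the limit
`lim_{q→1⁺} (q−1)^{N(1)} Z_N(q,q^{−s})`, cast to `ℂ`. [cite: Kurokawa2005ZetaF1, Thm. 2] -/
theorem tendsto_soule_limit_complex {N : ℤ[X]} {s : ℝ} (hs : (N.natDegree : ℝ) < s) :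
    Tendsto (fun q : ℝ => (((q - 1) ^ (N.eval 1) * f1HasseWeilZeta N q s : ℝ) : ℂ)) (𝓝[>] 1)
      (𝓝 (absoluteZeta N s)) := by
  rw [absoluteZeta_ofReal]
  exact (continuous_ofReal.tendsto _).comp (tendsto_soule_limit hs)

/-! ## §4. The divisor of `ζ_N` is supported on the integers `0, …, deg N` -/

/-- **Zeros and poles of `ζ_N` lie in `{0, 1, …, deg N}`**: `ζ_N(s) = ∏ (s−k)^{−a_k}` is zero-or-pole
(in Lean: takes the value `0`, poles being junk `0⁻¹ = 0`) at `s` iff `s = k` for some `k ≤ deg N`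
with `a_k ≠ 0` (a zero of order `−a_k` if `a_k < 0`, a pole of order `a_k` if `a_k > 0`); at every
other complex `s` it is a non-zero complex number. [cite: Kurokawa2005ZetaF1, Thm. 2 and Thm. 3 (poles at 0,…,n for P^n)]
[cite: ConnesConsani2010SchemesF1, §4.4 (display in the proof of Thm. 4.10)] -/
theorem absoluteZeta_eq_zero_iff (N : ℤ[X]) (s : ℂ) :
    absoluteZeta N s = 0 ↔ ∃ k ∈ range (N.natDegree + 1), s = k ∧ N.coeff k ≠ 0 := by
  rw [absoluteZeta, prod_eq_zero_iff]
  refine exists_congr fun k => and_congr_right fun _ => ?_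
  constructor
  · intro h
    have hne : -(N.coeff k) ≠ 0 := by
      intro h0
      rw [h0, zpow_zero] at h
      exact one_ne_zero h
    exact ⟨sub_eq_zero.mp ((zpow_eq_zero_iff hne).mp h), neg_ne_zero.mp hne⟩
  · rintro ⟨rfl, hk⟩
    rw [sub_self, zero_zpow _ (neg_ne_zero.mpr hk)]

/-- Reformulation with `k ≤ deg N`. [cite: Kurokawa2005ZetaF1, Thm. 2] -/
theorem absoluteZeta_eq_zero_iff' (N : ℤ[X]) (s : ℂ) :
    absoluteZeta N s = 0 ↔ ∃ k : ℕ, k ≤ N.natDegree ∧ s = k ∧ N.coeff k ≠ 0 := by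
  rw [absoluteZeta_eq_zero_iff]
  simp only [mem_range, Nat.lt_succ_iff]

/-- `ζ_N(s) ≠ 0` at every NON-REAL `s`: no zero (and no pole) of an `𝔽₁`-zeta function of a
counting polynomial lies off the real axis — in particular none lies at a non-trivial zero of `ζ`.
[cite: Kurokawa2005ZetaF1, Thm. 2] [cite: ConnesConsani2010SchemesF1, §1 pp. 2–3 and §4.4 eq. (4.7)] -/
theorem absoluteZeta_ne_zero_of_im_ne_zero (N : ℤ[X]) {s : ℂ} (hs : s.im ≠ 0) :
    absoluteZeta N s ≠ 0 := by
  rw [Ne, absoluteZeta_eq_zero_iff]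
  rintro ⟨k, -, rfl, -⟩
  simp at hs

/-- `ζ_N(s) ≠ 0` at every non-integral `s`. [cite: Kurokawa2005ZetaF1, Thm. 2] -/
theorem absoluteZeta_ne_zero_of_forall_ne_natCast (N : ℤ[X]) {s : ℂ} (hs : ∀ k : ℕ, s ≠ k) :
    absoluteZeta N s ≠ 0 := by
  rw [Ne, absoluteZeta_eq_zero_iff]
  rintro ⟨k, -, hk, -⟩
  exact hs k hk

/-! ## §5. Examples: `ℙ¹`, `𝔾_m` (Kurokawa's Theorem 3) -/

/-- `ℙ¹`: `N(x) = x + 1`, `ζ(s; ℙ¹/𝔽₁) = 1/(s(s−1))` — poles at `0` and `1`, no zeros.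
[cite: Kurokawa2005ZetaF1, Thm. 3 (2)] [cite: ConnesConsani2010SchemesF1, §4.4 example after Thm. 4.10] -/
theorem absoluteZeta_projectiveLine (s : ℂ) :
    absoluteZeta (X + 1) s = (s - 0) ^ (-1 : ℤ) * (s - 1) ^ (-1 : ℤ) := by
  have hd : (X + 1 : ℤ[X]).natDegree = 1 := by
    simpa using natDegree_X_add_C (1 : ℤ)
  simp [absoluteZeta, hd, prod_range_succ, coeff_one]

/-- `𝔾_m = GL₁`: `N(x) = x − 1`, `ζ(s; GL₁/𝔽₁) = s/(s−1)` — a ZERO at the integer `s = 0`, a pole at `1`.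
[cite: Kurokawa2005ZetaF1, Thm. 3 (3) with n = 1, and p. 183 "ζ(s; GL₁/𝔽₁) = s/(s−1)"] -/
theorem absoluteZeta_multiplicativeGroup (s : ℂ) :
    absoluteZeta (X - 1) s = (s - 0) ^ (1 : ℤ) * (s - 1) ^ (-1 : ℤ) := by
  have hd : (X - 1 : ℤ[X]).natDegree = 1 := by
    simpa using natDegree_X_sub_C (1 : ℤ)
  simp [absoluteZeta, hd, prod_range_succ, coeff_one]

/-! ## §6. The comparison with `ζ` and `ξ`: a certified non-trivial zero -/

/-- **A non-trivial zero of `ζ` on the critical line below height `101` exists** (indeed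
`N₀(101) = 29`, the tree's kernel-checked Backlund/Brent certificate
`Literature.NumberTheory.LFunctions.criticalZeroCount_hundredOne`; `ρ₁ = ½ + i·14.134…`).
[cite: Edwards1974, §6.6] -/
theorem exists_riemannZeta_zero_criticalLine :
    ∃ ρ : ℂ, riemannZeta ρ = 0 ∧ ρ.re = 1 / 2 ∧ 0 < ρ.im ∧ ρ.im ≤ 101 := by
  by_contra h
  push Not at h
  have hempty : {ρ ∈ zetaZeroBox (1 / 2) 101 | ρ.re = 1 / 2} = (∅ : Set ℂ) := by
    ext ρ
    simp only [zetaZeroBox, Set.mem_setOf_eq, Set.mem_empty_iff_false, iff_false, not_and]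
    intro hρ hre
    exact absurd hρ.2.2.2.2 (not_le.mpr (h ρ hρ.1 hre hρ.2.2.2.1))
  have h29 : criticalZeroCount 101 = 29 := criticalZeroCount_hundredOne
  rw [criticalZeroCount, hempty] at h29
  simp at h29

/-- **A zero of the completed zeta function `ξ = Λ`**: at a zero `ρ` of `ζ` with `Re ρ = ½` one has
`Λ(ρ) = 0` (`ζ = Λ/Γ_ℝ` and `Γ_ℝ(ρ) ≠ 0` for `Re ρ > 0`); the zero is the tree's certified `ρ₁`
(`Literature.NumberTheory.LFunctions.criticalZeroCount_hundredOne`). [cite: Edwards1974, §6.6] -/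
theorem exists_completedRiemannZeta_zero :
    ∃ ρ : ℂ, ρ.re = 1 / 2 ∧ 0 < ρ.im ∧ riemannZeta ρ = 0 ∧ completedRiemannZeta ρ = 0 := by
  obtain ⟨ρ, hζ, hre, him, -⟩ := exists_riemannZeta_zero_criticalLine
  refine ⟨ρ, hre, him, hζ, ?_⟩
  have hρ0 : ρ ≠ 0 := by
    rintro rfl
    norm_num at hre
  have hΓ : Gammaℝ ρ ≠ 0 := Gammaℝ_ne_zero_of_re_pos (by rw [hre]; norm_num)
  have h := riemannZeta_def_of_ne_zero hρ0
  rw [hζ, eq_comm, div_eq_zero_iff] at h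
  exact h.resolve_right hΓ

/-- **`ζ_N ≠ ξ`**: no counting polynomial has the completed Riemann zeta function as its `𝔽₁`-zeta
function — "since one expects `C` to be of infinite genus, `N(1)` is supposed to take the value `−∞`,
thus precluding any easy use of the limit definition of the zeta and a naive approach to the
definition of `C`, by generalizing the constructions of [Soulé]".
[cite: ConnesConsani2010SchemesF1, §1 pp. 2–3, Thm. 2.2, Remark 2.3] -/
theorem absoluteZeta_ne_completedRiemannZeta (N : ℤ[X]) : absoluteZeta N ≠ completedRiemannZeta := by
  obtain ⟨ρ, -, him, -, hΛ⟩ := exists_completedRiemannZeta_zero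
  intro h
  exact absoluteZeta_ne_zero_of_im_ne_zero N him.ne' (h ▸ hΛ)

/-- **`ζ_N ≠ ζ`**: no counting polynomial has the Riemann zeta function as its `𝔽₁`-zeta function.
[cite: ConnesConsani2010SchemesF1, §1 pp. 2–3] -/
theorem absoluteZeta_ne_riemannZeta (N : ℤ[X]) : absoluteZeta N ≠ riemannZeta := by
  obtain ⟨ρ, -, him, hζ, -⟩ := exists_completedRiemannZeta_zero
  intro h
  exact absoluteZeta_ne_zero_of_im_ne_zero N him.ne' (h ▸ hζ)

/-! ## §7. The technique class and the catalogued barrier -/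

/-- **Technique class** (D-0021): a function `Z : ℂ → ℂ` "is the `𝔽₁`-zeta function of a polynomial
counting function" — `Z = ζ_N = ∏_{k ≤ deg N}(s−k)^{−a_k}` for some `N = Σ a_k x^k ∈ ℤ[x]`, i.e. `Z` is
Soulé's/Kurokawa's `ζ(s; X/𝔽₁)` of a `ℤ`-scheme of `𝔽₁`-type (`#X(𝔽_q) = N(q)`), Deitmar's
`ζ_{X|𝔽₁}^{−1}` of an `𝔽₁`-scheme of finite type (zeta-polynomial `N`), Connes–Consani's `ζ_X` of a
Noetherian torsion-free `𝔽₁`-scheme. [cite: Kurokawa2005ZetaF1, Def. 1, Thm. 1, Thm. 2]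
[cite: Deitmar2006ZetaKTheoryF1, Thm. 1 and p. 141] [cite: ConnesConsani2010SchemesF1, Thm. 4.10] -/
def IsF1ZetaOfCountingPolynomial (Z : ℂ → ℂ) : Prop :=
  ∃ N : ℤ[X], Z = absoluteZeta N

/-- **Barrier: `𝔽₁`-zeta functions of polynomial counting functions have integral divisor and are
never `ξ` or `ζ`** (Soulé 2004 / Kurokawa 2005 / Deitmar 2006 / Connes–Consani 2010), PROVED as
`AbsoluteZetaPolynomialCounting_holds`.  Statement: (1) for every `N ∈ ℤ[x]`, `ζ_N(s) = 0` (zero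
or — junk value — pole) only at `s = k ∈ {0,…,deg N}` with `a_k ≠ 0`; (2) `ζ_N(s) ≠ 0` at every
non-real `s`; (3) there is a zero `ρ` of `ζ` AND of `ξ = Λ` with `Re ρ = ½`, `Im ρ > 0` (the tree's
certified `ρ₁`) at which every `ζ_N` is non-zero; (4) every member `Z` of the technique class
`IsF1ZetaOfCountingPolynomial` differs from `completedRiemannZeta` and from `riemannZeta`.

BARRIER (structured block, D-0021):
- technique_class: F1-geometry absolute-zeta Soule-limit polynomial-counting-function F1-type-scheme monoid-scheme Noetherian-F1-scheme cellular/toric/flag point counts; formally `IsF1ZetaOfCountingPolynomial Z :↔ ∃ N : ℤ[X], Z = absoluteZeta N`, `absoluteZeta N s = ∏_{k ≤ deg N} (s − k)^(−a_k)` = Soulé's `lim_{q→1}(q−1)^{N(1)} Z_N(q,q^{−s})` (`tendsto_soule_limit`) [cite: Kurokawa2005ZetaF1, Def. 1, Thm. 1, Thm. 2] [cite: Deitmar2006ZetaKTheoryF1, Thm. 1, p. 141] [cite: ConnesConsani2010SchemesF1, §2 (first display), Thm. 4.10]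
- blocks: a positive answer to Manin's question "a curve `C = Spec ℤ‾` over `𝔽₁` whose zeta function is the complete Riemann zeta function `ζ_ℚ(s) = π^{−s/2}Γ(s/2)ζ(s)`" INSIDE the class of objects with polynomial counting function (Soulé varieties over `𝔽₁`, Kurokawa's `𝔽₁`-type schemes, Deitmar's `𝔽₁`-schemes of finite type, Connes–Consani's Noetherian torsion-free `𝔽₁`-schemes — toric varieties, `G/P`, monoid schemes) [cite: ConnesConsani2010SchemesF1, §1 pp. 2–3 (Question, and "precluding any easy use of the limit definition of the zeta and a naive approach to the definition of C, by generalizing the constructions of [Soulé]")]; and, by clause (2) (`absoluteZeta_ne_zero_of_im_ne_zero`), any identification of a zero or pole of `ζ(s; X/𝔽₁)` with a non-real number, in particular with a non-trivial zero of `ζ` [cite: Kurokawa2005ZetaF1, Thm. 2, Thm. 3]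
- because: `ζ_N(s) = ∏_{k=0}^{deg N}(s−k)^{−a_k}` is a rational function whose zeros and poles are the INTEGERS `k ≤ deg N` with `a_k ≠ 0` (`absoluteZeta_eq_zero_iff`; e.g. `ζ(s;ℙⁿ/𝔽₁) = 1/(s(s−1)⋯(s−n))`, `ζ(s;GL₁/𝔽₁) = s/(s−1)`) [cite: Kurokawa2005ZetaF1, Thm. 2, Thm. 3, p. 183] [cite: Deitmar2006ZetaKTheoryF1, p. 141] [cite: ConnesConsani2010SchemesF1, §4.4], while `ξ` vanishes at a non-real point of the critical line (`exists_completedRiemannZeta_zero`, from the tree's certificate `N₀(101) = 29`; `ρ₁ = ½ + i·14.13…`) [cite: Edwards1974, §6.6]; in Euler-characteristic terms `N(1) = Σ a_k` is finite for a polynomial, whereas `ζ_N = ξ` forces `N(1) = −∞` ("infinite genus") [cite: ConnesConsani2010SchemesF1, §1 (3), Remark 2.3] [cite: Manin1995ZetaMotives, §1.5 (through ConnesConsani2010SchemesF1 §1)]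
- evasions_known: leave polynomials for DISTRIBUTIONS: Connes–Consani's Thm. 2.2 — the counting "function" of `C = Spec ℤ‾` is the positive distribution `N(u) = u − (d/du)(Σ_{ρ∈Z} order(ρ) u^{ρ+1}/(ρ+1)) + 1` on `[1,∞)`, determined from `−ζ_ℚ′/ζ_ℚ(s) = ∫_1^∞ N(u)u^{−s}d*u` (Lemma 2.1), with `N(1) = −∞ ∼ −½ E log E` reflecting the density of the zeros (Remark 2.3) — a counting distribution written in terms of the zeros themselves and expected to come from "a curve of adelic nature … with an action of the idele class group", i.e. the trace-formula interpretation of the explicit formulae on the adele class space ([Co-zeta], [CCM], [Meyer]) [cite: ConnesConsani2010SchemesF1, Thm. 2.2, Remark 2.3 and the paragraph following it]; none published inside the polynomial class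
- status: established (every clause machine-checked in this file from Mathlib and the tree's zero certificate; the printed sources are refereed)
- scope_caveats: (i) only zeta functions obtained from a POLYNOMIAL counting function by Soulé's limit (equivalently the closed form `∏(s−k)^{−a_k}`) are covered — nothing is said about counting distributions (Connes–Consani's `N(u)`), about Kurokawa–Ochiai-type absolute zeta functions of non-polynomial `N`, about Λ-ring / Witt-vector / Bost–Connes-type models of `𝔽₁`-geometry that carry operators rather than a counting polynomial, or about the later Connes–Consani programme (arithmetic and scaling sites, `H¹`, Riemann–Roch for `Spec ℤ‾`) [cite: ConnesConsani2010SchemesF1, §1, §2]; (ii) the sources prove the formula `ζ_N = ∏(s−k)^{−a_k}` and Connes–Consani print the obstruction in words (`N(1) = −∞` "precluding" Soulé-type constructions) — the inequality `ζ_N ≠ ξ` as a displayed theorem is this file's one-line consequence of those printed statements and of the existence of a non-real zero, not a numbered theorem of the sources [cite: ConnesConsani2010SchemesF1, §1 pp. 2–3]; (iii) the limit theorems here are for real `s > deg N` and `q → 1⁺` (where the Hasse–Weil series converges), the sign convention is Kurokawa's/Connes–Consani's (Soulé/Deitmar: inverse; same divisor support), and at a pole Lean's `absoluteZeta` takes the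 junk value `0`, so clause (1) is about the support of the divisor [cite: Kurokawa2005ZetaF1, Thm. 2, Remark 3].

[cite: ConnesConsani2010SchemesF1, §1 pp. 2–3, Thm. 2.2, Remark 2.3, Thm. 4.10] [cite: Kurokawa2005ZetaF1, Thm. 1, Thm. 2] [cite: Deitmar2006ZetaKTheoryF1, Thm. 1, p. 141] -/
def AbsoluteZetaPolynomialCounting : Prop :=
  (∀ (N : ℤ[X]) (s : ℂ), absoluteZeta N s = 0 → ∃ k : ℕ, k ≤ N.natDegree ∧ s = k ∧ N.coeff k ≠ 0) ∧
  (∀ (N : ℤ[X]) (s : ℂ), s.im ≠ 0 → absoluteZeta N s ≠ 0) ∧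
  (∃ ρ : ℂ, ρ.re = 1 / 2 ∧ 0 < ρ.im ∧ riemannZeta ρ = 0 ∧ completedRiemannZeta ρ = 0 ∧
      ∀ N : ℤ[X], absoluteZeta N ρ ≠ 0) ∧
  ∀ Z : ℂ → ℂ, IsF1ZetaOfCountingPolynomial Z → Z ≠ completedRiemannZeta ∧ Z ≠ riemannZeta

/-- **The barrier holds unconditionally** (all four clauses proved above).
[cite: ConnesConsani2010SchemesF1, §1 pp. 2–3, Thm. 4.10] [cite: Kurokawa2005ZetaF1, Thm. 2] -/
theorem AbsoluteZetaPolynomialCounting_holds : AbsoluteZetaPolynomialCounting := by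
  refine ⟨fun N s h => (absoluteZeta_eq_zero_iff' N s).mp h,
    fun N s hs => absoluteZeta_ne_zero_of_im_ne_zero N hs, ?_, ?_⟩
  · obtain ⟨ρ, hre, him, hζ, hΛ⟩ := exists_completedRiemannZeta_zero
    exact ⟨ρ, hre, him, hζ, hΛ, fun N => absoluteZeta_ne_zero_of_im_ne_zero N him.ne'⟩
  · rintro Z ⟨N, rfl⟩
    exact ⟨absoluteZeta_ne_completedRiemannZeta N, absoluteZeta_ne_riemannZeta N⟩

/-- Corollary in the words of Manin's question: no member of the technique class is the complete
Riemann zeta function `ζ_ℚ = Λ`. [cite: ConnesConsani2010SchemesF1, §1 p. 2 (Question)] -/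
theorem not_isF1ZetaOfCountingPolynomial_completedRiemannZeta :
    ¬ IsF1ZetaOfCountingPolynomial completedRiemannZeta := by
  rintro ⟨N, h⟩
  exact absoluteZeta_ne_completedRiemannZeta N h.symm

end Literature.Barriers.RiemannHypothesis
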